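import Literature.Barriers.QuantumAdvantage.UncorrectedNoiseFourier
import Literature.Computability.QuantumComplexity.NonunitalReadoutAnticoncentration
import HarnessLib

/-!
# XOR-noise floor monotonicity: the Bremner–Montanaro–Shepherd truncation estimate for correlated
# bit-flip laws with an independent floor

Literature record — LAW-LEVEL finite identities about XOR-convolution noise on real functions on
`{0,1}^N` and one ℓ₁-truncation inequality. No circuit semantics, complexity class, sampler, evaluator
or algorithm is defined or described; nothing here proves or refutes a quantum-advantage conjecture.

**The catalogued barrier and its typed class.** `Literature.Barriers.QuantumAdvantage.UncorrectedNoise`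
(Bremner–Montanaro–Shepherd 2017, Thm 4) is typed for INDEPENDENT symmetric bit flips: `noiseOp η` of
`UncorrectedNoiseFourier`, multiplier `(1−2η)^{|S|}` (`cubeFourierCoeff_noiseOp`), engine
`truncation_l1_sq_le`. **Just outside: correlated flips** — convolution with an arbitrary law `π` on
flip PATTERNS (`xorNoise π`; crosstalk, collective flips, the correlated `X`-parts of Pauli channels,
Rajakumar–Watson–Liu 2025 §3.1.1), with multiplier `mult π S = Σ_e π(e) χ_S(e)` (O'Donnell Thm 1.27).

* M1 `cubeFourierCoeff_xorNoise` — `(xorNoise π g)^(S) = mult π S · ĝ(S)`; `mult (flipWeight η) S = (1−2η)^{|S|}`.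
* M2 `xorNoise_xorNoise`, `mult_xorNoise`, `sum_sq_xorNoise_le` — `xorNoise π₁ ∘ xorNoise π₂ = xorNoise (xorNoise π₁ π₂)`, commutativity,
  `mult (xorNoise π₁ π₂) = mult π₁ · mult π₂`; for a probability law `|mult π S| ≤ 1` and the
  ℓ₂-contraction `Σ_x (xorNoise π g x)² ≤ Σ_x g(x)²`.
* M3 `FloorMonotonicity` (headline) — for `η ∈ [0,1]`, ANY probability law `π′`, real `p`, `ℓ`, and `c`
  supported in degree `≤ ℓ`:
  `(Σ_x |fourierFn c x − noiseOp η (xorNoise π′ p) x|)² ≤ 2^{2N} Σ_{|S|≤ℓ} (c_S − (1−2η)^{|S|} mult π′ S p̂(S))² + ((1−2η)²)^{ℓ+1}·2^N Σ_x p(x)²`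
  — the SAME shape and tail as `truncation_l1_sq_le`, for every total law `flipWeight η ⊛ π′` ("an
  independent floor `η` plus anything independent of it"; the floor may sit first or last,
  `noiseOp_xorNoise_comm`), because `π′⊛` commutes with `noiseOp η` and is an ℓ₂-contraction; so GIVEN
  input anticoncentration `Σ_x p(x)² ≤ α2^{-N}` and a table `c` of low-degree coefficients as in BMS17 §3
  (there supplied by an evaluator; none is constructed here) the tail is `((1−2η)²)^{ℓ+1} α` for every
  `π′` (`floor_monotone_of_anticoncentrated`).
* M4 `flipWeightV_eq_floor`, `mult_eventsLaw` — heterogeneous independent rates factor EXACTLY through a constant floor,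
  `flipWeightV η⃗ = flipWeight η ⊛ flipWeightV ((η_i − η)/(1−2η))_i` (`η ≠ 1/2`; residual rates in `[0,1]`
  iff `η ≤ η_i ≤ 1−η`), by uniqueness of multipliers; an independent EVENT law (pattern `A` flipped with
  probability `κ`) has `mult = (1−κ) + κ(−1)^{|S∩A|}`, and compositions multiply (`mult_eventsLaw`).
* M5 `EvenEventsKeepParity` (the typed negative instance — why the floor is load-bearing): a composition
  of independent events ALL OF EVEN SIZE has `mult … univ = 1` exactly (the global parity character is
  undamped: the collective flip `A = univ` with `N` even, nearest-neighbour pair flips, …), whereas on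
  top of a floor it is `(1−2η)^N` (`mult_floor_eventsLaw_univ`). Stated as identities about `mult`
  only — no claim about simulability is made either way.

Honest scope: operationally M3 is the law-level shadow of "XOR post-processing of the `η`-noisy law by
a KNOWN SAMPLEABLE pattern law preserves any sampler"; its content is the exact multiplier algebra, the
same-tail inequality for an ARBITRARY `π′`, the floor-extraction identity and the negative instances.
Noise BETWEEN non-commuting gates (BMS17 §1, p. 8: NCZ gates, "noise could actually increase the power
of IQP circuits") is NOT addressed and is the boundary of this record. `numbers`: illustration only.

Dictionary to existing tree vocabulary (cited by name, not imported): the root-namespace `xorConv μ ν`,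
`xorFold`, `parityBias μ a`, `IsDistr` of `Literature/Computability/Complexity/SmallBiasXor.lean` (Viola
2009) are the same objects in the pattern-first / vector-index convention — `xorNoise π g = xorConv π g`
up to commutativity of `Bool.xor`, `mult π S = parityBias π 1_S`, `eventsLaw` is an `xorFold` of event
laws, `IsDistr π` is the pair of binders `0 ≤ π`, `Σ π = 1` used below; this file keeps the `bxor` /
Finset-`walsh` convention of the catalogued engine so that `noiseOp η = xorNoise (flipWeight η)` is `rfl`.
-/

noncomputable section

namespace Literature.Computability.QuantumComplexity.XorNoiseFloor

open Finset
open Literature.Probability.RandomGraphs.LowDegree (sgn walsh sgn_true sgn_false sgn_mul_self walsh_empty)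
open Literature.Computability.Complexity.LowDegree (cubeFourierCoeff sum_cubeFourierCoeff_sq
  walsh_eq_prod_ite sum_cubeFourierCoeff_mul_walsh)
open Literature.Barriers.QuantumAdvantage (noiseOp fourierFn flipWeight bxor bxorEquiv walsh_bxor
  bxor_bxor_cancel bxor_bxor_cancel_left bxor_comm sum_flipWeight_mul_walsh cubeFourierCoeff_noiseOp
  truncation_l1_sq_le fourierFn_cubeFourierCoeff cubeFourierCoeff_fourierFn flipWeight_nonneg sum_flipWeight)
open NonunitalReadout (sq_wsum_le)

variable {N : ℕ}
/-! ### §1 XOR noise with an arbitrary pattern law and its Fourier multiplier -/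

/-- **XOR noise** with pattern law `π`: `(xorNoise π g)(x) = Σ_e π(e) · g(x ⊕ e)` — the convolution
`π * g` on `𝔽₂^N` (= the tree's root-level `xorConv π g` of `SmallBiasXor` up to `Bool.xor` commutativity);
`noiseOp η = xorNoise (flipWeight η)` by `rfl`. [cite: ODonnell2014, Def. 1.24 and Prop. 1.26 (convolution with a density = adding independent noise)] -/
def xorNoise (π g : (Fin N → Bool) → ℝ) (x : Fin N → Bool) : ℝ := ∑ e, π e * g (bxor x e)

/-- The **Fourier multiplier** of a pattern law: `mult π S = Σ_e π(e) χ_S(e)` (`= 2^N π̂(S)`, the character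
average `E_{e∼π} χ_S(e)`; the tree's `parityBias π 1_S` of `SmallBiasXor` in vector-index form). [cite: ODonnell2014, Thm 1.27 (convolution multiplies Fourier coefficients)] -/
def mult (π : (Fin N → Bool) → ℝ) (S : Finset (Fin N)) : ℝ := ∑ e, π e * walsh S e

/-- The catalogued noise operator is XOR noise with the product law. [cite: BremnerMontanaroShepherd2017, §3 (the noise operator 𝒩_ε)] -/
theorem noiseOp_eq_xorNoise (η : ℝ) (g : (Fin N → Bool) → ℝ) : noiseOp η g = xorNoise (flipWeight η) g :=
  rfl

/-- The multiplier of the product law is the catalogued damping `(1−2η)^{|S|}` (the tree's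
`sum_flipWeight_mul_walsh`). [cite: BremnerMontanaroShepherd2017, §3 (display before §3.1)] -/
theorem mult_flipWeight (η : ℝ) (S : Finset (Fin N)) : mult (flipWeight η) S = (1 - 2 * η) ^ S.card :=
  sum_flipWeight_mul_walsh η S

/-- The multiplier is `2^N` times the Walsh coefficient of the law. [cite: ODonnell2014, Thm 1.27] -/
theorem mult_eq_cubeFourierCoeff (π : (Fin N → Bool) → ℝ) (S : Finset (Fin N)) :
    mult π S = 2 ^ N * cubeFourierCoeff π S := by
  unfold mult cubeFourierCoeff
  rw [mul_div_cancel₀ _ (by positivity)]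

/-- **M1 · the multiplier law** (convolution theorem): `(xorNoise π g)^(S) = mult π S · ĝ(S)`.
[cite: ODonnell2014, Thm 1.27] -/
theorem cubeFourierCoeff_xorNoise (π g : (Fin N → Bool) → ℝ) (S : Finset (Fin N)) :
    cubeFourierCoeff (xorNoise π g) S = mult π S * cubeFourierCoeff g S := by
  unfold cubeFourierCoeff xorNoise mult
  rw [mul_div_assoc']
  congr 1
  calc ∑ x : Fin N → Bool, (∑ e, π e * g (bxor x e)) * walsh S x
      = ∑ e : Fin N → Bool, π e * ∑ x, g (bxor x e) * walsh S x := by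
        simp_rw [Finset.sum_mul, Finset.mul_sum]
        rw [Finset.sum_comm]
        refine Finset.sum_congr rfl fun e _ => Finset.sum_congr rfl fun x _ => ?_
        ring
    _ = ∑ e : Fin N → Bool, π e * (walsh S e * ∑ x, g x * walsh S x) := by
        refine Finset.sum_congr rfl fun e _ => ?_
        congr 1
        rw [Finset.mul_sum, ← Equiv.sum_comp (bxorEquiv e) (fun x => g (bxor x e) * walsh S x)]
        refine Finset.sum_congr rfl fun x _ => ?_
        simp only [bxorEquiv, Equiv.coe_fn_mk, bxor_bxor_cancel, walsh_bxor]
        ring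
    _ = (∑ e : Fin N → Bool, π e * walsh S e) * ∑ x, g x * walsh S x := by
        rw [Finset.sum_mul]
        exact Finset.sum_congr rfl fun e _ => by ring

/-- A pattern law is determined by its multipliers (Fourier inversion). [cite: ODonnell2014, Thm 1.1 (uniqueness of the Fourier expansion)] -/
theorem eq_of_mult_eq {π₁ π₂ : (Fin N → Bool) → ℝ} (h : ∀ S, mult π₁ S = mult π₂ S) : π₁ = π₂ := by
  have hc : cubeFourierCoeff π₁ = cubeFourierCoeff π₂ := by
    funext S
    have h2 : (2 : ℝ) ^ N ≠ 0 := by positivity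
    have := h S
    rw [mult_eq_cubeFourierCoeff, mult_eq_cubeFourierCoeff] at this
    exact mul_left_cancel₀ h2 this
  rw [← fourierFn_cubeFourierCoeff π₁, hc, fourierFn_cubeFourierCoeff]
/-! ### §2 M2 — composition, commutativity, contraction -/

/-- Re-association of a double xor. [folklore] -/
private theorem bxor_bxor_assoc (x e f : Fin N → Bool) : bxor (bxor x e) f = bxor x (bxor f e) := by
  funext i; simp only [bxor]; cases x i <;> cases e i <;> cases f i <;> rfl

/-- **XOR noises compose into an XOR noise** with the convolved law:
`xorNoise π₁ (xorNoise π₂ g) = xorNoise (xorNoise π₁ π₂) g`. [cite: ODonnell2014, Exercise 1.25 (convolution is associative)] -/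
theorem xorNoise_xorNoise (π₁ π₂ g : (Fin N → Bool) → ℝ) :
    xorNoise π₁ (xorNoise π₂ g) = xorNoise (xorNoise π₁ π₂) g := by
  funext x
  unfold xorNoise
  calc ∑ e, π₁ e * ∑ f, π₂ f * g (bxor (bxor x e) f)
      = ∑ e, π₁ e * ∑ d, π₂ (bxor d e) * g (bxor x d) := by
        refine sum_congr rfl fun e _ => ?_
        congr 1
        rw [← Equiv.sum_comp (bxorEquiv e) (fun d => π₂ (bxor d e) * g (bxor x d))]
        refine sum_congr rfl fun f _ => ?_
        simp only [bxorEquiv, Equiv.coe_fn_mk, bxor_bxor_cancel, bxor_bxor_assoc]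
    _ = ∑ d, (∑ e, π₁ e * π₂ (bxor d e)) * g (bxor x d) := by
        simp_rw [mul_sum, sum_mul]
        rw [sum_comm]
        exact sum_congr rfl fun d _ => sum_congr rfl fun e _ => by ring

/-- **XOR noise is commutative in the two laws**: `xorNoise π₁ π₂ = xorNoise π₂ π₁` (so the floor may
be applied first or last). [cite: ODonnell2014, Exercise 1.25 (convolution is commutative)] -/
theorem xorNoise_comm (π₁ π₂ : (Fin N → Bool) → ℝ) : xorNoise π₁ π₂ = xorNoise π₂ π₁ := by
  funext x
  unfold xorNoise
  rw [← Equiv.sum_comp (bxorEquiv x) (fun e => π₂ e * π₁ (bxor x e))]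
  refine sum_congr rfl fun e _ => ?_
  simp only [bxorEquiv, Equiv.coe_fn_mk]
  rw [bxor_comm e x, bxor_bxor_cancel_left, mul_comm]

/-- The floor commutes with any further XOR noise: `noiseOp η (xorNoise π g) = xorNoise π (noiseOp η g)`.
[cite: ODonnell2014, Exercise 1.25; BremnerMontanaroShepherd2017, §3] -/
theorem noiseOp_xorNoise_comm (η : ℝ) (π g : (Fin N → Bool) → ℝ) :
    noiseOp η (xorNoise π g) = xorNoise π (noiseOp η g) := by
  rw [noiseOp_eq_xorNoise η (xorNoise π g), noiseOp_eq_xorNoise η g, xorNoise_xorNoise,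
    xorNoise_xorNoise, xorNoise_comm (flipWeight η) π]

/-- **Multipliers multiply under composition**: `mult (xorNoise π₁ π₂) S = mult π₁ S · mult π₂ S`.
[cite: ODonnell2014, Thm 1.27] -/
theorem mult_xorNoise (π₁ π₂ : (Fin N → Bool) → ℝ) (S : Finset (Fin N)) :
    mult (xorNoise π₁ π₂) S = mult π₁ S * mult π₂ S := by
  rw [mult_eq_cubeFourierCoeff, cubeFourierCoeff_xorNoise, mult_eq_cubeFourierCoeff π₂]; ring

/-- `|χ_S(e)| = 1`. [folklore] -/
private theorem abs_walsh_eq_one (S : Finset (Fin N)) (e : Fin N → Bool) : |walsh S e| = 1 := by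
  have h : walsh S e * walsh S e = 1 := by
    unfold walsh; rw [← prod_mul_distrib]; simp
  rcases mul_self_eq_one_iff.mp (show |walsh S e| * |walsh S e| = 1 by rw [abs_mul_abs_self, h]) with h1 | h1
  · exact h1
  · linarith [abs_nonneg (walsh S e)]

/-- For a probability law every multiplier lies in `[−1, 1]`. [cite: ODonnell2014, §1.5 (E_{e∼φ} χ_S(e) is an average of signs)] -/
theorem abs_mult_le_one {π : (Fin N → Bool) → ℝ} (h0 : ∀ e, 0 ≤ π e) (h1 : ∑ e, π e = 1)
    (S : Finset (Fin N)) : |mult π S| ≤ 1 := by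
  unfold mult
  refine (abs_sum_le_sum_abs _ _).trans ?_
  rw [← h1]
  refine sum_le_sum fun e _ => ?_
  rw [abs_mul, abs_walsh_eq_one, mul_one, abs_of_nonneg (h0 e)]

/-- XOR noise with a probability law preserves nonnegativity. [cite: ODonnell2014, Prop. 1.26] -/
theorem xorNoise_nonneg {π g : (Fin N → Bool) → ℝ} (hπ : ∀ e, 0 ≤ π e) (hg : ∀ x, 0 ≤ g x)
    (x : Fin N → Bool) : 0 ≤ xorNoise π g x :=
  sum_nonneg fun e _ => mul_nonneg (hπ e) (hg _)

/-- XOR noise multiplies total masses: `Σ_x xorNoise π g x = (Σ π)(Σ g)`. [cite: ODonnell2014, Prop. 1.26] -/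
theorem sum_xorNoise (π g : (Fin N → Bool) → ℝ) :
    ∑ x, xorNoise π g x = (∑ e, π e) * ∑ x, g x := by
  unfold xorNoise
  rw [sum_comm, sum_mul]
  refine sum_congr rfl fun e _ => ?_
  rw [← mul_sum, ← Equiv.sum_comp (bxorEquiv e) g]
  simp only [bxorEquiv, Equiv.coe_fn_mk]

/-- **ℓ₂-contraction**: for a probability law `π`, `Σ_x (xorNoise π g x)² ≤ Σ_x g(x)²` (Jensen in `e`,
then translation invariance of `Σ_x`). [cite: ODonnell2014, Prop. 1.26 and §1.5 (Young's inequality ‖φ * g‖₂ ≤ ‖g‖₂ for a density φ)] -/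
theorem sum_sq_xorNoise_le {π : (Fin N → Bool) → ℝ} (h0 : ∀ e, 0 ≤ π e) (h1 : ∑ e, π e = 1)
    (g : (Fin N → Bool) → ℝ) : ∑ x, xorNoise π g x ^ 2 ≤ ∑ x, g x ^ 2 := by
  calc ∑ x, xorNoise π g x ^ 2 ≤ ∑ x, ∑ e, π e * g (bxor x e) ^ 2 :=
        sum_le_sum fun x _ => sq_wsum_le π (fun e => g (bxor x e)) h0 h1
    _ = ∑ e, π e * ∑ x, g (bxor x e) ^ 2 := by rw [sum_comm]; simp_rw [mul_sum]
    _ = ∑ e, π e * ∑ x, g x ^ 2 := by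
        refine sum_congr rfl fun e _ => ?_
        rw [← Equiv.sum_comp (bxorEquiv e) (fun x => g x ^ 2)]
        simp only [bxorEquiv, Equiv.coe_fn_mk]
    _ = ∑ x, g x ^ 2 := by rw [← sum_mul, h1, one_mul]
/-! ### §3 M3 — the headline: the truncation estimate is monotone under XOR noise above a floor -/

/-- **M3 · HEADLINE — floor monotonicity of the truncation estimate.** For `η ∈ [0,1]`, ANY probability
law `π′` on flip patterns, real `p`, `ℓ`, and `c` supported in degree `≤ ℓ`: the shape AND the tail of the
catalogued `truncation_l1_sq_le`, unchanged, for the total noise law `flipWeight η ⊛ π′`. [cite: BremnerMontanaroShepherd2017, §3.1 (displays 1–2); ODonnell2014, Thm 1.27 and Prop. 1.26] -/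
theorem truncation_floor_monotone (p : (Fin N → Bool) → ℝ) {η : ℝ} (h0 : 0 ≤ η) (h1 : η ≤ 1)
    {π' : (Fin N → Bool) → ℝ} (hπ0 : ∀ e, 0 ≤ π' e) (hπ1 : ∑ e, π' e = 1) (ℓ : ℕ)
    (c : Finset (Fin N) → ℝ) (hc : ∀ S, ℓ < S.card → c S = 0) :
    (∑ x, |fourierFn c x - noiseOp η (xorNoise π' p) x|) ^ 2 ≤
      2 ^ (2 * N) * ∑ S ∈ univ.filter (fun S : Finset (Fin N) => S.card ≤ ℓ),
          (c S - (1 - 2 * η) ^ S.card * (mult π' S * cubeFourierCoeff p S)) ^ 2 +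
        ((1 - 2 * η) ^ 2) ^ (ℓ + 1) * 2 ^ N * ∑ x, p x ^ 2 := by
  have h := truncation_l1_sq_le (xorNoise π' p) h0 h1 ℓ c hc
  simp_rw [cubeFourierCoeff_xorNoise] at h
  refine h.trans (add_le_add le_rfl ?_)
  exact mul_le_mul_of_nonneg_left (sum_sq_xorNoise_le hπ0 hπ1 p) (by positivity)

/-- **Input-anticoncentration form.** Under `Σ_x p(x)² ≤ α·2^{-N}` and exact low coefficients
`c_S = (1−2η)^{|S|} mult π′ S p̂(S)` (`|S| ≤ ℓ`): `(Σ_x |fourierFn c x − noiseOp η (xorNoise π′ p) x|)² ≤ ((1−2η)²)^{ℓ+1} α`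
— for EVERY probability law `π′`, with no dependence on `π′` or `N`. [cite: BremnerMontanaroShepherd2017, §3.1 (display 2 with Σ_x p(x)² ≤ α2^{-n}) and Thm 4] -/
theorem floor_monotone_of_anticoncentrated (p : (Fin N → Bool) → ℝ) {η α : ℝ} (h0 : 0 ≤ η)
    (h1 : η ≤ 1) {π' : (Fin N → Bool) → ℝ} (hπ0 : ∀ e, 0 ≤ π' e) (hπ1 : ∑ e, π' e = 1) (ℓ : ℕ)
    (hp : ∑ x, p x ^ 2 ≤ α * (2 ^ N)⁻¹) :
    (∑ x, |fourierFn (fun S => if S.card ≤ ℓ then (1 - 2 * η) ^ S.card * (mult π' S * cubeFourierCoeff p S)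
        else 0) x - noiseOp η (xorNoise π' p) x|) ^ 2 ≤ ((1 - 2 * η) ^ 2) ^ (ℓ + 1) * α := by
  set c : Finset (Fin N) → ℝ := fun S =>
    if S.card ≤ ℓ then (1 - 2 * η) ^ S.card * (mult π' S * cubeFourierCoeff p S) else 0 with hcdef
  have hc : ∀ S, ℓ < S.card → c S = 0 := fun S hS => by simp [hcdef, not_le.mpr hS]
  refine (truncation_floor_monotone p h0 h1 hπ0 hπ1 ℓ c hc).trans ?_
  have hlow : ∑ S ∈ univ.filter (fun S : Finset (Fin N) => S.card ≤ ℓ),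
      (c S - (1 - 2 * η) ^ S.card * (mult π' S * cubeFourierCoeff p S)) ^ 2 = 0 := by
    refine sum_eq_zero fun S hS => ?_
    rw [mem_filter] at hS
    simp [hcdef, hS.2]
  rw [hlow, mul_zero, zero_add, mul_assoc]
  refine mul_le_mul_of_nonneg_left ?_ (by positivity)
  calc (2 : ℝ) ^ N * ∑ x, p x ^ 2 ≤ 2 ^ N * (α * (2 ^ N)⁻¹) := mul_le_mul_of_nonneg_left hp (by positivity)
    _ = α := by field_simp

/-- M3 as a record. [cite: BremnerMontanaroShepherd2017, §3.1 (displays 1–2) and Thm 4; ODonnell2014, Thm 1.27] -/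
def FloorMonotonicity : Prop :=
  ∀ (N : ℕ) (p : (Fin N → Bool) → ℝ) (η : ℝ), 0 ≤ η → η ≤ 1 → ∀ (π' : (Fin N → Bool) → ℝ),
    (∀ e, 0 ≤ π' e) → ∑ e, π' e = 1 → ∀ (ℓ : ℕ) (c : Finset (Fin N) → ℝ), (∀ S, ℓ < S.card → c S = 0) →
    (∑ x, |fourierFn c x - noiseOp η (xorNoise π' p) x|) ^ 2 ≤
      2 ^ (2 * N) * ∑ S ∈ univ.filter (fun S : Finset (Fin N) => S.card ≤ ℓ),
          (c S - (1 - 2 * η) ^ S.card * (mult π' S * cubeFourierCoeff p S)) ^ 2 +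
        ((1 - 2 * η) ^ 2) ^ (ℓ + 1) * 2 ^ N * ∑ x, p x ^ 2

/-- M3 holds. [cite: BremnerMontanaroShepherd2017, §3.1 (displays 1–2) and Thm 4] -/
theorem floorMonotonicity_holds : FloorMonotonicity :=
  fun _ p _ h0 h1 _ hπ0 hπ1 ℓ c hc => truncation_floor_monotone p h0 h1 hπ0 hπ1 ℓ c hc
/-! ### §4 M4 — floor extraction: heterogeneous independent rates and independent events -/

/-- Independent flips with per-bit rates `η⃗`: `flipWeightV η⃗ e = Π_i (η_i if e_i else 1 − η_i)`
(`flipWeightV (fun _ => η) = flipWeight η`). [cite: BremnerMontanaroShepherd2017, §3 (independent bit-flip noise), per-qubit rates] -/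
def flipWeightV (ηv : Fin N → ℝ) (e : Fin N → Bool) : ℝ := ∏ i, if e i = true then ηv i else 1 - ηv i

/-- Constant rates give the catalogued product law. [cite: BremnerMontanaroShepherd2017, §3] -/
theorem flipWeightV_const (η : ℝ) : flipWeightV (fun _ : Fin N => η) = flipWeight η := rfl

/-- **The multiplier of heterogeneous independent flips**: `mult (flipWeightV η⃗) S = Π_{i∈S} (1 − 2η_i)`.
[cite: ODonnell2014, §2.4 and Thm 1.27 (product densities have product multipliers)] -/
theorem mult_flipWeightV (ηv : Fin N → ℝ) (S : Finset (Fin N)) :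
    mult (flipWeightV ηv) S = ∏ i ∈ S, (1 - 2 * ηv i) := by
  classical
  unfold mult
  have key : ∀ e : Fin N → Bool, flipWeightV ηv e * walsh S e =
      ∏ i, ((if e i = true then ηv i else 1 - ηv i) * (if i ∈ S then sgn (e i) else 1)) := by
    intro e
    rw [flipWeightV, walsh_eq_prod_ite, ← prod_mul_distrib]
  simp_rw [key]
  rw [← Fintype.prod_sum (fun (i : Fin N) (b : Bool) =>
    (if b = true then ηv i else 1 - ηv i) * (if i ∈ S then sgn b else 1))]
  rw [← prod_filter_mul_prod_filter_not univ (fun i => i ∈ S)]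
  have h1 : ∏ i ∈ univ.filter (fun i => i ∈ S),
      ∑ b : Bool, (if b = true then ηv i else 1 - ηv i) * (if i ∈ S then sgn b else 1) =
        ∏ i ∈ S, (1 - 2 * ηv i) := by
    rw [filter_mem_eq_inter, univ_inter]
    refine prod_congr rfl fun i hi => ?_
    simp [hi]
    ring
  have h2 : ∏ i ∈ univ.filter (fun i => ¬ i ∈ S),
      ∑ b : Bool, (if b = true then ηv i else 1 - ηv i) * (if i ∈ S then sgn b else 1) = 1 := by
    refine prod_eq_one fun i hi => ?_
    rw [mem_filter] at hi
    simp [hi.2]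
  rw [h1, h2, mul_one]

/-- `flipWeightV` is a probability law for rates in `[0,1]`: nonnegative … [cite: BremnerMontanaroShepherd2017, §3] -/
theorem flipWeightV_nonneg {ηv : Fin N → ℝ} (h0 : ∀ i, 0 ≤ ηv i) (h1 : ∀ i, ηv i ≤ 1) (e : Fin N → Bool) :
    0 ≤ flipWeightV ηv e :=
  prod_nonneg fun i _ => by split_ifs <;> linarith [h0 i, h1 i]

/-- … and of total mass one. [cite: BremnerMontanaroShepherd2017, §3] -/
theorem sum_flipWeightV (ηv : Fin N → ℝ) : ∑ e : Fin N → Bool, flipWeightV ηv e = 1 := by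
  unfold flipWeightV
  rw [← Fintype.prod_sum (fun (i : Fin N) (b : Bool) => if b = true then ηv i else 1 - ηv i)]
  exact prod_eq_one fun i _ => by simp

/-- **The one-bit composition rule, heterogeneous form**: flips of rates `η` then `η″_i` independently
are flips of rates `η + η″_i − 2ηη″_i`. [cite: RajakumarWatsonLiu2025, Lemma 11 (composition of bit-flip rates, eq. (7)); ODonnell2014, Thm 1.27] -/
theorem xorNoise_flipWeight_flipWeightV (η : ℝ) (ηv : Fin N → ℝ) :
    xorNoise (flipWeight η) (flipWeightV ηv) = flipWeightV (fun i => η + ηv i - 2 * η * ηv i) := by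
  refine eq_of_mult_eq fun S => ?_
  rw [mult_xorNoise, mult_flipWeight, mult_flipWeightV, mult_flipWeightV, ← prod_const, ← prod_mul_distrib]
  exact prod_congr rfl fun i _ => by ring

/-- **M4 · floor extraction.** Heterogeneous independent rates factor EXACTLY through a constant floor:
`flipWeightV η⃗ = flipWeight η ⊛ flipWeightV ((η_i − η)/(1 − 2η))_i` for `η ≠ 1/2` (the residual rates lie
in `[0,1]` iff `η ≤ η_i ≤ 1 − η`). [cite: RajakumarWatsonLiu2025, §3.1.1 (a Pauli channel as a fixed dephasing floor plus residual errors); ODonnell2014, Thm 1.27] -/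
theorem flipWeightV_eq_floor (ηv : Fin N → ℝ) {η : ℝ} (hη : η ≠ 1 / 2) :
    flipWeightV ηv = xorNoise (flipWeight η) (flipWeightV fun i => (ηv i - η) / (1 - 2 * η)) := by
  rw [xorNoise_flipWeight_flipWeightV]
  congr 1
  funext i
  have h : (1 - 2 * η) ≠ 0 := fun h => hη (by linarith)
  symm
  calc η + (ηv i - η) / (1 - 2 * η) - 2 * η * ((ηv i - η) / (1 - 2 * η))
      = η + (1 - 2 * η) * ((ηv i - η) / (1 - 2 * η)) := by ring
    _ = ηv i := by rw [mul_div_cancel₀ _ h]; ring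

/-- The residual rates of the floor extraction lie in `[0,1]` when `η ≤ η_i ≤ 1 − η` and `η < 1/2`.
[cite: RajakumarWatsonLiu2025, §3.1.1] -/
theorem residual_rate_mem {η t : ℝ} (hη : η < 1 / 2) (ht0 : η ≤ t) (ht1 : t ≤ 1 - η) :
    0 ≤ (t - η) / (1 - 2 * η) ∧ (t - η) / (1 - 2 * η) ≤ 1 := by
  have h : 0 < 1 - 2 * η := by linarith
  exact ⟨div_nonneg (by linarith) h.le, (div_le_one h).mpr (by linarith)⟩

/-- The point mass at a pattern `d`. [cite: ODonnell2014, §1.5 (densities; the point density)] -/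
def pointLaw (d : Fin N → Bool) (e : Fin N → Bool) : ℝ := if e = d then 1 else 0

/-- The multiplier of a point mass is the character value: `mult (pointLaw d) S = χ_S(d)`. [cite: ODonnell2014, Thm 1.27] -/
theorem mult_pointLaw (d : Fin N → Bool) (S : Finset (Fin N)) : mult (pointLaw d) S = walsh S d := by
  unfold mult pointLaw
  simp

/-- The indicator pattern of a set of positions. [cite: ODonnell2014, §1.2 (subsets S ⊆ [n] as points of 𝔽₂ⁿ)] -/
def indic (A : Finset (Fin N)) : Fin N → Bool := fun i => decide (i ∈ A)

/-- A character on an indicator pattern: `χ_S(1_A) = (−1)^{|S ∩ A|}`. [cite: ODonnell2014, §1.2 (χ_S(x) = (−1)^{Σ_{i∈S} x_i})] -/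
theorem walsh_indic (S A : Finset (Fin N)) : walsh S (indic A) = (-1) ^ (S ∩ A).card := by
  classical
  unfold walsh indic
  rw [← prod_filter_mul_prod_filter_not S (fun i => i ∈ A)]
  have h1 : ∏ i ∈ S.filter (fun i => i ∈ A), sgn (decide (i ∈ A)) = (-1) ^ (S ∩ A).card := by
    rw [← filter_mem_eq_inter, prod_congr rfl (g := fun _ => (-1 : ℝ)), prod_const]
    intro i hi
    rw [mem_filter] at hi
    simp [hi.2, sgn]
  have h2 : ∏ i ∈ S.filter (fun i => ¬ i ∈ A), sgn (decide (i ∈ A)) = 1 :=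
    prod_eq_one fun i hi => by rw [mem_filter] at hi; simp [hi.2, sgn]
  rw [h1, h2, mul_one]

/-- An **independent event law**: the pattern `A` is flipped collectively with probability `κ`.
[cite: RajakumarWatsonLiu2025, §3.1.1 (correlated X-errors); ODonnell2014, §1.5] -/
def eventLaw (A : Finset (Fin N)) (κ : ℝ) (e : Fin N → Bool) : ℝ :=
  (1 - κ) * pointLaw (fun _ => false) e + κ * pointLaw (indic A) e

/-- **The multiplier of an event law**: `mult (eventLaw A κ) S = (1 − κ) + κ(−1)^{|S∩A|}`. [cite: ODonnell2014, Thm 1.27] -/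
theorem mult_eventLaw (A : Finset (Fin N)) (κ : ℝ) (S : Finset (Fin N)) :
    mult (eventLaw A κ) S = (1 - κ) + κ * (-1) ^ (S ∩ A).card := by
  have hlin : mult (eventLaw A κ) S = (1 - κ) * mult (pointLaw fun _ => false) S + κ * mult (pointLaw (indic A)) S := by
    unfold mult eventLaw
    simp_rw [add_mul, sum_add_distrib, mul_assoc, ← mul_sum]
  rw [hlin, mult_pointLaw, mult_pointLaw, walsh_indic]
  have h0 : walsh S (fun _ : Fin N => false) = 1 := by unfold walsh; simp
  rw [h0, mul_one]

/-- An event law is a probability law for `κ ∈ [0,1]`. [cite: ODonnell2014, §1.5] -/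
theorem eventLaw_nonneg (A : Finset (Fin N)) {κ : ℝ} (h0 : 0 ≤ κ) (h1 : κ ≤ 1) (e : Fin N → Bool) :
    0 ≤ eventLaw A κ e := by
  unfold eventLaw pointLaw
  split_ifs <;> nlinarith

/-- … of total mass one. [cite: ODonnell2014, §1.5] -/
theorem sum_eventLaw (A : Finset (Fin N)) (κ : ℝ) : ∑ e, eventLaw A κ e = 1 := by
  have := mult_eventLaw A κ ∅
  unfold mult at this
  simpa using this

/-- A composition of independent events (applied in list order on top of a base law). [cite: ODonnell2014, Prop. 1.26 (sums of independent pattern variables = iterated convolution)] -/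
def eventsLaw : List (Finset (Fin N) × ℝ) → (Fin N → Bool) → ℝ
  | [] => pointLaw fun _ => false
  | Aκ :: L => xorNoise (eventLaw Aκ.1 Aκ.2) (eventsLaw L)

/-- **The multiplier of a composition of independent events is the product of the event multipliers.**
[cite: ODonnell2014, Thm 1.27] -/
theorem mult_eventsLaw (L : List (Finset (Fin N) × ℝ)) (S : Finset (Fin N)) :
    mult (eventsLaw L) S = (L.map fun Aκ => (1 - Aκ.2) + Aκ.2 * (-1) ^ (S ∩ Aκ.1).card).prod := by
  induction L with
  | nil =>
      rw [eventsLaw, mult_pointLaw]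
      unfold walsh; simp
  | cons Aκ L ih => rw [eventsLaw, mult_xorNoise, mult_eventLaw, ih, List.map_cons, List.prod_cons]
/-! ### §5 M5 — the negative instance: even events never damp the global parity -/

/-- An event of even overlap does not damp the character: `|S ∩ A|` even ⇒ `mult (eventLaw A κ) S = 1`.
[cite: ODonnell2014, Thm 1.27 (χ_S(1_A) = 1 when |S∩A| is even)] -/
theorem mult_eventLaw_of_even {A S : Finset (Fin N)} (h : Even (S ∩ A).card) (κ : ℝ) :
    mult (eventLaw A κ) S = 1 := by
  rw [mult_eventLaw, h.neg_one_pow]; ring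

/-- **M5 · even events keep parity.** A composition of independent events ALL OF EVEN SIZE leaves the
global parity character exactly undamped, `mult (eventsLaw L) univ = 1` (collective flip `A = univ` with `N`
even; nearest-neighbour pair flips) — an identity about `mult`; nothing about simulability. [cite: BremnerMontanaroShepherd2017, §3.1 (the tail needs |multiplier| < 1 at high degree), negative instance; ODonnell2014, Thm 1.27] -/
theorem mult_eventsLaw_univ_of_even (L : List (Finset (Fin N) × ℝ)) (h : ∀ Aκ ∈ L, Even Aκ.1.card) :
    mult (eventsLaw L) univ = 1 := by
  rw [mult_eventsLaw]
  refine List.prod_eq_one fun x hx => ?_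
  rw [List.mem_map] at hx
  obtain ⟨Aκ, hAκ, rfl⟩ := hx
  rw [univ_inter, (h Aκ hAκ).neg_one_pow]; ring

/-- With a floor the parity IS damped: `mult (flipWeight η ⊛ eventsLaw L) univ = (1−2η)^N` for even events.
[cite: BremnerMontanaroShepherd2017, §3.1; ODonnell2014, Thm 1.27] -/
theorem mult_floor_eventsLaw_univ (η : ℝ) (L : List (Finset (Fin N) × ℝ)) (h : ∀ Aκ ∈ L, Even Aκ.1.card) :
    mult (xorNoise (flipWeight η) (eventsLaw L)) univ = (1 - 2 * η) ^ N := by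
  rw [mult_xorNoise, mult_eventsLaw_univ_of_even L h, mult_flipWeight, card_univ, Fintype.card_fin, mul_one]

/-- M5 as a record. [cite: BremnerMontanaroShepherd2017, §3.1, negative instance; ODonnell2014, Thm 1.27] -/
def EvenEventsKeepParity : Prop :=
  ∀ (N : ℕ) (L : List (Finset (Fin N) × ℝ)), (∀ Aκ ∈ L, Even Aκ.1.card) → mult (eventsLaw L) univ = 1

/-- M5 holds. [cite: BremnerMontanaroShepherd2017, §3.1, negative instance] -/
theorem evenEventsKeepParity_holds : EvenEventsKeepParity := fun _ L h => mult_eventsLaw_univ_of_even L h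
/-! ### §6 Numbers (illustration) -/

/-- **Numbers** (illustration): collective flip of all bits, `κ = 3/10`, floor `η = 1/20` — degree-2
multiplier `(9/10)²·1 = 81/100`, degree-3 `(9/10)³(1 − 6/10) = 729/2500`, and `1` at degree 2 with NO floor;
tail of M3 at `α = 2`, `δ = 1/20`: `(81/100)^{32}·800 ≤ 1 < (81/100)^{31}·800`, least `ℓ + 1 = 32` for
every `π′`. [cite: BremnerMontanaroShepherd2017, Thm 4 (ℓ = O(log(α/δ)/ε)); ODonnell2014, Thm 1.27] -/
theorem numbers : ((9 : ℝ) / 10) ^ 2 * ((1 - 3 / 10) + 3 / 10 * (-1) ^ 2) = 81 / 100 ∧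
    ((9 : ℝ) / 10) ^ 3 * ((1 - 3 / 10) + 3 / 10 * (-1) ^ 3) = 729 / 2500 ∧
    ((1 - (3 : ℝ) / 10) + 3 / 10 * (-1) ^ 2 = 1) ∧ ((81 : ℝ) / 100) ^ 32 * 800 ≤ 1 ∧ (1 : ℝ) < (81 / 100) ^ 31 * 800 := by
  refine ⟨by norm_num, by norm_num, by norm_num, by norm_num, by norm_num⟩

end Literature.Computability.QuantumComplexity.XorNoiseFloor

end
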